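import Mathlib

/-!
# T6N5LocalValuedTorsion — Tier 6, M2 sub-step N5 (t6-p8's half): elements close to `1` in Mathlib's completion of a
number field are not roots of unity (residue characteristic `2`)

In `L_w = w.adicCompletion L`, when `v(2) ≤ v(p)` for every prime `p` (residue characteristic `2`), an element
`z ≠ 1` with `v(z − 1) < v(2)` is not a root of unity: `z^p − 1 = (z − 1)·Φ_p(z)` with
`Φ_p(z) = p + (z − 1)·S` (`geom_sum_sub_natCast`) and `v(Φ_p(z)) = v(p)` (`pow_prime_ne_one_of_val_sub_one_lt`);
then strong induction through the least prime factor (`pow_ne_one_of_val_sub_one_lt`). Used by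
`T6N5LocalGaussianRefutation` to produce an element of infinite order in `L_w^×/K_v^×` at `ℚ₂ ⊆ ℚ₂(i)`.
README §8(d): uses an L-value-free non-vanishing device: NO.
-/

namespace Summit.Ventures.HodgeRepro2.T6.N5LocalValuedTorsion

open IsDedekindDomain HeightOneSpectrum

noncomputable section

/-! ### Roots of unity close to `1` in a valued field of residue characteristic `2` -/

section Torsion

variable {L : Type} [Field L] [NumberField L] (w : HeightOneSpectrum (NumberField.RingOfIntegers L))

/-- `v(n) ≤ 1` for a natural number `n`. -/
theorem val_natCast_le_one (n : ℕ) : Valued.v ((n : ℕ) : w.adicCompletion L) ≤ 1 := by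
  induction n with
  | zero => simp
  | succ n ih =>
    rw [Nat.cast_succ]
    exact (Valuation.map_add_le_max' _ _ _).trans (max_le ih (le_of_eq (Valuation.map_one _)))

/-- `v(z^m − 1) ≤ v(z − 1)` for `z` with `v z ≤ 1`. -/
theorem val_pow_sub_one_le (z : w.adicCompletion L) (hz : Valued.v z ≤ 1) (m : ℕ) :
    Valued.v (z ^ m - 1) ≤ Valued.v (z - 1) := by
  rw [← geom_sum_mul, map_mul]
  have hs : Valued.v (∑ i ∈ Finset.range m, z ^ i) ≤ 1 :=
    Valuation.map_sum_le _ fun i _ => by rw [map_pow]; exact pow_le_one₀ zero_le hz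
  calc Valued.v (∑ i ∈ Finset.range m, z ^ i) * Valued.v (z - 1)
      ≤ 1 * Valued.v (z - 1) := mul_le_mul' hs le_rfl
    _ = Valued.v (z - 1) := one_mul _

/-- `Φ_p(z) − p = (z − 1)·S` with `S` a sum of powers of `z`. -/
theorem geom_sum_sub_natCast (z : w.adicCompletion L) (p : ℕ) :
    (∑ i ∈ Finset.range p, z ^ i) - (p : w.adicCompletion L) =
      (z - 1) * ∑ i ∈ Finset.range p, ∑ j ∈ Finset.range i, z ^ j := by
  have h : ∀ i : ℕ, z ^ i - 1 = (z - 1) * ∑ j ∈ Finset.range i, z ^ j := fun i => by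
    rw [mul_comm, geom_sum_mul]
  calc (∑ i ∈ Finset.range p, z ^ i) - (p : w.adicCompletion L)
      = ∑ i ∈ Finset.range p, (z ^ i - 1) := by
        rw [Finset.sum_sub_distrib, Finset.sum_const, Finset.card_range, nsmul_eq_mul, mul_one]
    _ = ∑ i ∈ Finset.range p, (z - 1) * ∑ j ∈ Finset.range i, z ^ j := Finset.sum_congr rfl fun i _ => h i
    _ = (z - 1) * ∑ i ∈ Finset.range p, ∑ j ∈ Finset.range i, z ^ j := by rw [Finset.mul_sum]

/-- A prime power of `z ≠ 1` with `v(z − 1) < v(2)` is not `1`, when `v(2) ≤ v(p)` for every prime `p`. -/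
theorem pow_prime_ne_one_of_val_sub_one_lt (hp2 : ∀ p : ℕ, p.Prime → Valued.v (2 : w.adicCompletion L) ≤
      Valued.v ((p : ℕ) : w.adicCompletion L))
    (z : w.adicCompletion L) (hz1 : z ≠ 1) (hv : Valued.v (z - 1) < Valued.v (2 : w.adicCompletion L))
    (p : ℕ) (hp : p.Prime) : z ^ p ≠ 1 := by
  have hz : Valued.v z ≤ 1 := by
    have h2le : Valued.v (2 : w.adicCompletion L) ≤ 1 := by
      have := val_natCast_le_one w 2
      simpa using this
    have h1 : Valued.v (z - 1) < 1 := lt_of_lt_of_le hv h2le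
    have : z = (z - 1) + 1 := by ring
    rw [this]
    exact (Valuation.map_add_le_max' _ _ _).trans (max_le h1.le (le_of_eq (Valuation.map_one _)))
  have hS : Valued.v (∑ i ∈ Finset.range p, ∑ j ∈ Finset.range i, z ^ j) ≤ 1 :=
    Valuation.map_sum_le _ fun i _ => Valuation.map_sum_le _ fun j _ => by
      rw [map_pow]; exact pow_le_one₀ zero_le hz
  have hz1' : Valued.v (z - 1) ≠ 0 := by
    rw [Ne, Valuation.zero_iff, sub_eq_zero]
    exact hz1
  -- `v(Φ_p(z)) = v(p)`
  have hΦ : Valued.v (∑ i ∈ Finset.range p, z ^ i) = Valued.v ((p : ℕ) : w.adicCompletion L) := by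
    have heq : (∑ i ∈ Finset.range p, z ^ i) =
        (z - 1) * (∑ i ∈ Finset.range p, ∑ j ∈ Finset.range i, z ^ j) + (p : w.adicCompletion L) := by
      rw [← geom_sum_sub_natCast]; ring
    rw [heq]
    apply Valuation.map_add_eq_of_lt_right
    rw [map_mul]
    calc Valued.v (z - 1) * Valued.v (∑ i ∈ Finset.range p, ∑ j ∈ Finset.range i, z ^ j)
        ≤ Valued.v (z - 1) * 1 := mul_le_mul' le_rfl hS
      _ = Valued.v (z - 1) := mul_one _
      _ < Valued.v (2 : w.adicCompletion L) := hv
      _ ≤ Valued.v ((p : ℕ) : w.adicCompletion L) := hp2 p hp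
  have hp0 : Valued.v ((p : ℕ) : w.adicCompletion L) ≠ 0 := by
    haveI : CharZero (w.adicCompletion L) :=
      charZero_of_injective_algebraMap (algebraMap L (w.adicCompletion L)).injective
    rw [Ne, Valuation.zero_iff]
    exact_mod_cast hp.ne_zero
  intro h
  have h' : z ^ p - 1 = 0 := sub_eq_zero.mpr h
  rw [← geom_sum_mul] at h'
  have := congrArg Valued.v h'
  rw [map_mul, hΦ, Valuation.map_zero] at this
  exact mul_ne_zero hp0 hz1' this

/-- `z ≠ 1` with `v(z − 1) < v(2)` is not a root of unity (when `v(2) ≤ v(p)` for every prime `p`). -/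
theorem pow_ne_one_of_val_sub_one_lt (hp2 : ∀ p : ℕ, p.Prime → Valued.v (2 : w.adicCompletion L) ≤
      Valued.v ((p : ℕ) : w.adicCompletion L))
    (z : w.adicCompletion L) (hz1 : z ≠ 1) (hv : Valued.v (z - 1) < Valued.v (2 : w.adicCompletion L)) :
    ∀ n : ℕ, 1 ≤ n → z ^ n ≠ 1 := by
  have hz : Valued.v z ≤ 1 := by
    have h2le : Valued.v (2 : w.adicCompletion L) ≤ 1 := by
      have := val_natCast_le_one w 2
      simpa using this
    have h1 : Valued.v (z - 1) < 1 := lt_of_lt_of_le hv h2le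
    have : z = (z - 1) + 1 := by ring
    rw [this]
    exact (Valuation.map_add_le_max' _ _ _).trans (max_le h1.le (le_of_eq (Valuation.map_one _)))
  intro n
  induction n using Nat.strong_induction_on with
  | _ n ih =>
    intro hn
    rcases Nat.lt_or_ge n 2 with hlt | hge
    · have : n = 1 := by omega
      subst this
      rw [pow_one]
      exact hz1
    · have hne1 : n ≠ 1 := by omega
      set p := n.minFac with hpdef
      have hp : p.Prime := Nat.minFac_prime hne1
      obtain ⟨m, hm⟩ := Nat.minFac_dvd n
      have hm1 : 1 ≤ m := by
        rcases Nat.eq_zero_or_pos m with h0 | h0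
        · rw [h0, mul_zero] at hm; omega
        · exact h0
      have hmn : m < n := by
        rw [hm]
        have := hp.two_le
        nlinarith
      rw [hm, pow_mul']
      by_cases hzm : z ^ m = 1
      · exact absurd hzm (ih m hmn hm1)
      · have hvm : Valued.v (z ^ m - 1) < Valued.v (2 : w.adicCompletion L) :=
          lt_of_le_of_lt (val_pow_sub_one_le w z hz m) hv
        exact pow_prime_ne_one_of_val_sub_one_lt w hp2 (z ^ m) hzm hvm p hp

end Torsion

end

end Summit.Ventures.HodgeRepro2.T6.N5LocalValuedTorsion
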